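import Summits.ValiantsHypothesis.ValiantsHypothesis.Theorems.BarrierLeverAnchoredDoorHitsLowerPairsDTPeelSpec

/-!
# Support item `AnchoredDoorHitsLowerPairs` (stmt-ValiantsHypothesis-22510), line `anchored-peeling`:
# the DECISION-TREE PEEL LEMMA (one `x`-vertex, any type list) for the anchored door 𝔄_s

Helper file (`--supports stmt-ValiantsHypothesis-22510`; cell valiant-natproofs, rung V4, 𝒟-side door (c); registered line
`Cruxes/AnchoredDoorHitsLowerPairs/Lines/anchored_peeling.lean` v5, open stubs `stub_rigidPairs` / `stub_vertexStep`; prover seat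
val-np-p1 gen 17). Definition-free. Closes NO item.

**THE DT-PEEL LEMMA (`genDet_ne_zero_of_peel`).** Work with GENERALIZED ROWS `(U | E)` of the anchored door (entry against the
column `T`: `[E ⊆ T]·[x^U y^{T∖E}] 𝔄_s`, file `…DTPeelSpec`). Fix an `x`-vertex `a` and a TYPE LIST `(B_j, c_j, D_j)_{j<J}`:
`x`-tail sets `B_j ∌ a`, pairwise DISTINCT anchor columns `c_j`, `y`-tail sets `D_j ∌ c_j`. Give every LINK ROW (`a ∈ U`) its
CLASS `cls i` = the FIRST `j` with `B_j ⊆ U ∖ a`, and PEEL it to `(U ∖ a ∖ B_{cls} | E ⊔ c_{cls} ⊔ D_{cls})` (disjoint union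
required); rows with `a ∉ U` are kept. THEN: if the peeled generalized minor is a nonzero polynomial, so is the original one.
PROOF. Under the one-variable substitution `dtSpec` of `…DTPeelSpec` every entry of a link row of class `j₀` is a `T`-polynomial
of degree `≤ W_{j₀} = (J-1-j₀) + 2h(J+1)` (`natDegree_linkEntry_le`): a term «anchor `(a|c_j)`, `x`-tails `B' ⊆ B_j ∩ (U∖a)`,
`y`-tails `D' ⊆ D_j`» has degree `(J-1-j) + (2h - |B_j| - |D_j| + |B'| + |D'|)(J+1)`, which for `j < j₀` loses a full tail weight
`J+1 > J-1` (`B_j ⊄ U∖a` by minimality), for `j > j₀` loses in the first summand, and for `j = j₀` reaches `W_{j₀}` exactly at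
full tails — where the coefficient is the PEELED entry (`coeff_linkEntry_top`); rows without `a` are constants equal to their own
entries (`dtHom_genEntry_of_not_mem`). The top `T`-coefficient of the substituted determinant under these ROW degree bounds is the
peeled determinant (`coeff_det_of_natDegree_le_row`, file `…StarSpec`), whence the lemma. The reading is thus UNIQUE by a degree
count — no cancellation analysis. SPECIAL CASES: one type `(∅, c, ∅)` with `|lk_a R| = |lk_c C|` is the `s = 1` star step
(`stub_starStep`); full sheds `B_j = U∖a` give the distinct-anchor (SDR) certificates of `…DistinctAnchors`; the general case
interpolates and iterates: an `x`-side ROUTING (peel every `x`-vertex, ending in unit rows `(∅ | E(S))` with `S ↦ E(S)` a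
bijection onto the columns) certifies `symbolicDet ≠ 0` (sequel file). Memo: HOME/val-np-p1/g17/DTPEEL-MEMO-valnp1-g17.md.

WHAT THIS IS NOT: no statement about items 22510 / 19717 themselves (the existence of routings for all simplicial pairs is the
line's open combinatorial question); nothing on crux stmt-ValiantsHypothesis-14610 or on `VP` versus `VNP`.
-/

set_option linter.dupNamespace false

namespace Summit.ValiantsHypothesis.ValiantsHypothesis.Theorems.BarrierLever.AnchoredPeeling

open Finset MvPolynomial
open Summit.ValiantsHypothesis.ValiantsHypothesis.Theorems.BarrierLever.BrickCalculus
  (pexpo pexpo_def pexpo_le_iff pexpo_sub pexpo_apply_castAdd pexpo_apply_natAdd)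

noncomputable section

namespace DTPeel

variable {h : ℕ}

/-! ## 1. Coefficients of `G · ∏ (1 + x_v · Q_i)` -/

section ProdOneAdd

variable {R : Type*} [CommSemiring R] {σ : Type*} {ι : Type*}

/-- `∏_{i ∈ s} (1 + X_v Q_i) = 1 + X_v · K` for some `K`. -/
theorem exists_prod_one_add_X_mul (v : σ) (s : Finset ι) (Q : ι → MvPolynomial σ R) :
    ∃ K : MvPolynomial σ R, ∏ i ∈ s, (1 + X v * Q i) = 1 + X v * K := by
  classical
  induction s using Finset.induction_on with
  | empty => exact ⟨0, by simp⟩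
  | insert i s hi ih =>
    obtain ⟨K, hK⟩ := ih
    refine ⟨K + Q i + X v * K * Q i, ?_⟩
    rw [Finset.prod_insert hi, hK]
    ring

/-- On a `v`-free monomial the factor `∏ (1 + X_v Q_i)` is invisible. -/
theorem coeff_mul_prod_one_add_of_zero (v : σ) (s : Finset ι) (Q : ι → MvPolynomial σ R) (G : MvPolynomial σ R)
    {m : σ →₀ ℕ} (hm : m v = 0) : coeff m (G * ∏ i ∈ s, (1 + X v * Q i)) = coeff m G := by
  classical
  obtain ⟨K, hK⟩ := exists_prod_one_add_X_mul v s Q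
  rw [hK, mul_add, mul_one, coeff_add, mul_left_comm, coeff_X_mul', if_neg (by
    rw [Finsupp.mem_support_iff, hm]; exact fun h' => h' rfl), add_zero]

/-- **On a monomial linear in `x_v`**, with `G` free of `x_v`:
`[m] (G · ∏_{i∈s} (1 + X_v Q_i)) = Σ_{i∈s} [m - e_v] (G · Q_i)`. -/
theorem coeff_mul_prod_one_add_of_one (v : σ) (s : Finset ι) (Q : ι → MvPolynomial σ R) (G : MvPolynomial σ R)
    (hG : ∀ m' : σ →₀ ℕ, m' v ≠ 0 → coeff m' G = 0) {m : σ →₀ ℕ} (hm : m v = 1) :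
    coeff m (G * ∏ i ∈ s, (1 + X v * Q i)) = ∑ i ∈ s, coeff (m - Finsupp.single v 1) (G * Q i) := by
  classical
  have hv : v ∈ m.support := by rw [Finsupp.mem_support_iff, hm]; exact one_ne_zero
  have hm0 : (m - Finsupp.single v 1 : σ →₀ ℕ) v = 0 := by
    rw [Finsupp.tsub_apply, Finsupp.single_eq_same, hm]
  induction s using Finset.induction_on with
  | empty => rw [Finset.prod_empty, mul_one, Finset.sum_empty]; exact hG m (by rw [hm]; exact one_ne_zero)
  | insert i s hi ih =>
    have hring : G * ((1 + X v * Q i) * ∏ x ∈ s, (1 + X v * Q x)) =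
        G * ∏ x ∈ s, (1 + X v * Q x) + X v * ((G * Q i) * ∏ x ∈ s, (1 + X v * Q x)) := by ring
    rw [Finset.prod_insert hi, Finset.sum_insert hi, hring, coeff_add, ih, coeff_X_mul', if_pos hv,
      coeff_mul_prod_one_add_of_zero v s Q _ hm0, add_comm]

end ProdOneAdd

/-! ## 2. The entries of the substituted generalized layout -/

section Entries

variable {s : ℕ} {a : Fin h} {J : ℕ} {B : Fin J → Finset (Fin h)} {c : Fin J → Fin h} {D : Fin J → Finset (Fin h)}

/-- `x^{B'} · y^{c ⊔ D'}` as one monomial. -/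
theorem X_mul_prod_mul_prod_eq_monomial {R : Type*} [CommSemiring R] (cj : Fin h) (B' D' : Finset (Fin h))
    (hc : cj ∉ D') :
    (X (Fin.natAdd h cj) * (∏ b ∈ B', X (Fin.castAdd h b)) * (∏ d ∈ D', X (Fin.natAdd h d)) :
        MvPolynomial (Fin (h + h)) R) = monomial (pexpo B' (insert cj D')) 1 := by
  rw [prod_X_eq_monomial', prod_X_eq_monomial', X, monomial_mul, monomial_mul, one_mul, one_mul, pexpo_def,
    Finset.sum_insert hc]
  congr 1
  abel

/-- The `Q`-polynomial of type `j` expanded into monomials. -/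
theorem Qpoly_eq_sum (j : Fin J) (hcD : c j ∉ D j) :
    Qpoly B c D j = ∑ B' ∈ (B j).powerset, ∑ D' ∈ (D j).powerset,
      C (Polynomial.X ^ (anchW B D j + (B'.card + D'.card) * tailW J)) * monomial (pexpo B' (insert (c j) D')) 1 := by
  rw [Qpoly, prod_one_add_C_mul_X, prod_one_add_C_mul_X, mul_assoc _ (∑ Z ∈ (B j).powerset, _), Finset.sum_mul_sum,
    Finset.mul_sum]
  refine Finset.sum_congr rfl (fun B' _ => ?_)
  rw [Finset.mul_sum]
  refine Finset.sum_congr rfl (fun D' hD' => ?_)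
  have hc : c j ∉ D' := fun h' => hcD (Finset.mem_powerset.mp hD' h')
  rw [← X_mul_prod_mul_prod_eq_monomial (R := Polynomial (MvPolynomial (Param h) ℂ)) (c j) B' D' hc, ← pow_mul,
    ← pow_mul, add_mul, pow_add, pow_add, map_mul, map_mul]
  ring

/-- **Coefficients of `F0 · Q_j` at an `a`-free monomial**:
`[x^{U'} y^V] (F0 · Q_j) = Σ_{B' ⊆ B_j, D' ⊆ D_j} [B' ⊆ U' ∧ c_j ⊔ D' ⊆ V] · T^{Lt j + (|B'|+|D'|)L} · [x^{U'∖B'} y^{V∖(c_j ⊔ D')}] 𝔄_s`. -/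
theorem coeff_F0_mul_Qpoly (j : Fin J) (hcD : c j ∉ D j) (U' V : Finset (Fin h)) (haU : a ∉ U') :
    coeff (pexpo U' V) (F0 s h a * Qpoly B c D j) =
      ∑ B' ∈ (B j).powerset, ∑ D' ∈ (D j).powerset,
        (if B' ⊆ U' ∧ insert (c j) D' ⊆ V then
          Polynomial.monomial (anchW B D j + (B'.card + D'.card) * tailW J)
            (coeff (pexpo (U' \ B') (V \ insert (c j) D')) (symbolicWitness s h))
        else 0) := by
  classical
  rw [Qpoly_eq_sum j hcD, Finset.mul_sum, coeff_sum]
  refine Finset.sum_congr rfl (fun B' _ => ?_)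
  rw [Finset.mul_sum, coeff_sum]
  refine Finset.sum_congr rfl (fun D' _ => ?_)
  rw [mul_left_comm, coeff_C_mul, coeff_mul_monomial']
  by_cases hle : B' ⊆ U' ∧ insert (c j) D' ⊆ V
  · rw [if_pos ((pexpo_le_iff _ _ _ _).mpr hle), if_pos hle, mul_one, pexpo_sub _ _ _ _ hle.1 hle.2,
      coeff_F0 s (U' \ B') (V \ insert (c j) D') (fun h' => haU (Finset.mem_sdiff.mp h').1), mul_comm,
      Polynomial.C_mul_X_pow_eq_monomial]
  · rw [if_neg (fun h' => hle ((pexpo_le_iff _ _ _ _).mp h')), if_neg hle, mul_zero]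

/-- `pexpo U V - e_{x_a} = pexpo (U.erase a) V` for `a ∈ U`. -/
theorem pexpo_sub_single {a : Fin h} {U : Finset (Fin h)} (V : Finset (Fin h)) (ha : a ∈ U) :
    pexpo U V - Finsupp.single (xv h a) 1 = pexpo (U.erase a) V := by
  have h1 : Finsupp.single (xv h a) 1 = pexpo ({a} : Finset (Fin h)) ∅ := by
    rw [pexpo_def, Finset.sum_singleton, Finset.sum_empty, add_zero]
  rw [h1, pexpo_sub _ _ _ _ (Finset.singleton_subset_iff.mpr ha) (Finset.empty_subset V), Finset.sdiff_empty,
    Finset.erase_eq]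

/-- A designated anchor lies in `anchors s h` (`s ≥ 1`) and contains `a`. -/
theorem anch_mem_filter (hs : 1 ≤ s) (j : Fin J) :
    anch a c j ∈ (anchors s h).filter (fun α => a ∈ α.1) := by
  simp only [anch, anchors, Finset.mem_filter, Finset.mem_univ, true_and, Finset.card_singleton, Finset.mem_singleton,
    and_true]
  exact ⟨le_refl 1, hs, le_refl 1, hs⟩

/-- **Link-row entries after the substitution.** For `a ∈ U`:
`[x^U y^V] dtSpec(𝔄_s) = Σ_j [x^{U∖a} y^V] (F0 · Q_j)`. -/
theorem coeff_map_dtHom_of_mem (hs : 1 ≤ s) (hc : Function.Injective c) (haB : ∀ j, a ∉ B j) (hcD : ∀ j, c j ∉ D j)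
    (U V : Finset (Fin h)) (haU : a ∈ U) :
    coeff (pexpo U V) (MvPolynomial.map (dtHom a B c D) (symbolicWitness s h)) =
      ∑ j, coeff (pexpo (U.erase a) V) (F0 s h a * Qpoly B c D j) := by
  classical
  rw [map_dtHom_symbolicWitness s h a B c D hc haB hcD,
    coeff_mul_prod_one_add_of_one (xv h a) _ _ _ (fun m' hm' => coeff_F0_eq_zero hm')
      (by rw [pexpo_apply_castAdd, if_pos haU]),
    pexpo_sub_single V haU]
  simp_rw [Finset.mul_sum, coeff_sum]
  exact Finset.sum_fiberwise_of_maps_to (s := univ) (t := (anchors s h).filter (fun α => a ∈ α.1))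
    (g := fun j => anch a c j) (fun j _ => anch_mem_filter hs j)
    (fun j => coeff (pexpo (U.erase a) V) (F0 s h a * Qpoly B c D j))

/-- **Rows without `a` after the substitution**: constants, equal to the original entries. -/
theorem coeff_map_dtHom_of_not_mem (hc : Function.Injective c) (haB : ∀ j, a ∉ B j) (hcD : ∀ j, c j ∉ D j)
    (U V : Finset (Fin h)) (haU : a ∉ U) :
    coeff (pexpo U V) (MvPolynomial.map (dtHom a B c D) (symbolicWitness s h)) =
      Polynomial.C (coeff (pexpo U V) (symbolicWitness s h)) := by
  classical
  rw [map_dtHom_symbolicWitness s h a B c D hc haB hcD,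
    coeff_mul_prod_one_add_of_zero (xv h a) _ _ _ (by rw [pexpo_apply_castAdd, if_neg haU]),
    coeff_F0 s U V haU]

end Entries

/-! ## 3. Degrees and top coefficients; the DT-peel lemma -/

section Peel

variable {s : ℕ} {a : Fin h} {J : ℕ} {B : Fin J → Finset (Fin h)} {c : Fin J → Fin h} {D : Fin J → Finset (Fin h)}

/-- The weight arithmetic (products treated as atoms). With `n = (J-1-j) + (2h-e)(J+1)` and `top = (J-1-j₀) + 2h(J+1)`:
if `j₀ ≤ j` then `n ≤ top` with equality only for `j = j₀, e = 0`; if `j < j₀` and `e ≥ 1` then `n < top`. -/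
theorem weight_arith (J h j j₀ e : ℕ) (hj : j < J) (hj₀ : j₀ < J) (he : e ≤ 2 * h) :
    ((j₀ ≤ j → (J - 1 - j) + (2 * h - e) * (J + 1) ≤ (J - 1 - j₀) + 2 * h * (J + 1)) ∧
      (j₀ ≤ j → (J - 1 - j) + (2 * h - e) * (J + 1) = (J - 1 - j₀) + 2 * h * (J + 1) → j = j₀ ∧ e = 0)) ∧
      (j < j₀ → 1 ≤ e → (J - 1 - j) + (2 * h - e) * (J + 1) < (J - 1 - j₀) + 2 * h * (J + 1)) := by
  have hsplit : (2 * h - e) * (J + 1) + e * (J + 1) = 2 * h * (J + 1) := by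
    rw [← Nat.add_mul, Nat.sub_add_cancel he]
  have hY : J + 1 ≤ e * (J + 1) ∨ e = 0 := by
    rcases Nat.eq_zero_or_pos e with h0 | hpos
    · exact Or.inr h0
    · exact Or.inl (Nat.le_mul_of_pos_left (J + 1) hpos)
  refine ⟨⟨fun hle => by omega, fun hle heq => ?_⟩, fun hlt h1 => ?_⟩
  · rcases hY with hY | hY
    · exact absurd heq (by omega)
    · subst hY; simp only [Nat.zero_mul] at hsplit; exact ⟨by omega, rfl⟩
  · rcases hY with hY | hY
    · omega
    · omega

/-- The weight of the term «type `j`, `x`-tails `B'`, `y`-tails `D'`» in deficit form. -/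
theorem weight_eq (j : Fin J) {B' D' : Finset (Fin h)} (hB' : B' ⊆ B j) (hD' : D' ⊆ D j) :
    anchW B D j + (B'.card + D'.card) * tailW J =
      (J - 1 - j) + (2 * h - (((B j).card - B'.card) + ((D j).card - D'.card))) * (J + 1) := by
  have hBj : (B j).card ≤ h := (Finset.card_le_univ _).trans_eq (Fintype.card_fin h)
  have hDj : (D j).card ≤ h := (Finset.card_le_univ _).trans_eq (Fintype.card_fin h)
  have hB'' := Finset.card_le_card hB'
  have hD'' := Finset.card_le_card hD'
  rw [anchW, tailW, add_assoc, ← Nat.add_mul]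
  congr 2
  omega

/-- **Degree bound for one term of a link-row entry.** If `j₀` is the first type with `B_{j₀} ⊆ U ∖ a`, every present term
«`j`, `B' ⊆ B_j ∩ (U ∖ a)`, `D' ⊆ D_j`» has weight `≤ W_{j₀}`, with equality only for `(j, B', D') = (j₀, B_{j₀}, D_{j₀})`. -/
theorem weight_le_topW (j₀ j : Fin J) {Ua B' D' : Finset (Fin h)} (hmin : ∀ j', j' < j₀ → ¬ B j' ⊆ Ua)
    (hB' : B' ⊆ B j) (hD' : D' ⊆ D j) (hB'U : B' ⊆ Ua) :
    anchW B D j + (B'.card + D'.card) * tailW J ≤ topW h J j₀ ∧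
      (anchW B D j + (B'.card + D'.card) * tailW J = topW h J j₀ → j = j₀ ∧ B' = B j ∧ D' = D j) := by
  have hBj : (B j).card ≤ h := (Finset.card_le_univ _).trans_eq (Fintype.card_fin h)
  have hDj : (D j).card ≤ h := (Finset.card_le_univ _).trans_eq (Fintype.card_fin h)
  have hB'' := Finset.card_le_card hB'
  have hD'' := Finset.card_le_card hD'
  have he : ((B j).card - B'.card) + ((D j).card - D'.card) ≤ 2 * h := by omega
  obtain ⟨⟨hA1, hA2⟩, hB⟩ := weight_arith J h j j₀ (((B j).card - B'.card) + ((D j).card - D'.card)) j.isLt j₀.isLt he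
  rw [weight_eq j hB' hD', topW, tailW]
  by_cases hjj : j₀ ≤ j
  · refine ⟨hA1 hjj, fun heq => ?_⟩
    obtain ⟨hj, he0⟩ := hA2 hjj heq
    refine ⟨Fin.ext hj, Finset.eq_of_subset_of_card_le hB' (by omega), Finset.eq_of_subset_of_card_le hD' (by omega)⟩
  · have hlt : j < j₀ := lt_of_not_ge hjj
    have hne : B' ≠ B j := fun heq => hmin j hlt (heq ▸ hB'U)
    have hcard : B'.card < (B j).card := Finset.card_lt_card (lt_of_le_of_ne hB' hne)
    have hstrict := hB hlt (by omega)
    exact ⟨le_of_lt hstrict, fun heq => absurd heq (ne_of_lt hstrict)⟩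

/-- **The substituted entry of a LINK row** (`a ∈ U`, `E ⊆ T`), as a triple sum of weighted monomials. -/
theorem dtHom_genEntry_of_mem (hs : 1 ≤ s) (hc : Function.Injective c) (haB : ∀ j, a ∉ B j)
    (hcD : ∀ j, c j ∉ D j) (U E T : Finset (Fin h)) (haU : a ∈ U) (hET : E ⊆ T) :
    dtHom a B c D (genEntry s h U E T) =
      ∑ j, ∑ B' ∈ (B j).powerset, ∑ D' ∈ (D j).powerset,
        (if B' ⊆ U.erase a ∧ insert (c j) D' ⊆ T \ E then
          Polynomial.monomial (anchW B D j + (B'.card + D'.card) * tailW J)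
            (coeff (pexpo ((U.erase a) \ B') ((T \ E) \ insert (c j) D')) (symbolicWitness s h))
        else 0) := by
  rw [genEntry, if_pos hET, ← coeff_map, coeff_map_dtHom_of_mem hs hc haB hcD U (T \ E) haU]
  exact Finset.sum_congr rfl (fun j _ => coeff_F0_mul_Qpoly j (hcD j) (U.erase a) (T \ E) (Finset.notMem_erase a U))

/-- **The substituted entry of a row WITHOUT `a`**: the constant `genEntry`. -/
theorem dtHom_genEntry_of_not_mem (hc : Function.Injective c) (haB : ∀ j, a ∉ B j) (hcD : ∀ j, c j ∉ D j)
    (U E T : Finset (Fin h)) (haU : a ∉ U) :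
    dtHom a B c D (genEntry s h U E T) = Polynomial.C (genEntry s h U E T) := by
  rw [genEntry]
  by_cases hET : E ⊆ T
  · rw [if_pos hET, ← coeff_map, coeff_map_dtHom_of_not_mem hc haB hcD U (T \ E) haU]
  · rw [if_neg hET, map_zero, map_zero]

/-- Degree bound for a link-row entry: `≤ W_{j₀}`. -/
theorem natDegree_linkEntry_le (hs : 1 ≤ s) (hc : Function.Injective c) (haB : ∀ j, a ∉ B j)
    (hcD : ∀ j, c j ∉ D j) (U E T : Finset (Fin h)) (haU : a ∈ U) (j₀ : Fin J)
    (hmin : ∀ j', j' < j₀ → ¬ B j' ⊆ U.erase a) :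
    (dtHom a B c D (genEntry s h U E T)).natDegree ≤ topW h J j₀ := by
  by_cases hET : E ⊆ T
  · rw [dtHom_genEntry_of_mem hs hc haB hcD U E T haU hET]
    refine Polynomial.natDegree_sum_le_of_forall_le _ _ (fun j _ => ?_)
    refine Polynomial.natDegree_sum_le_of_forall_le _ _ (fun B' hB' => ?_)
    refine Polynomial.natDegree_sum_le_of_forall_le _ _ (fun D' hD' => ?_)
    split_ifs with hcond
    · exact (Polynomial.natDegree_monomial_le _).trans
        (weight_le_topW j₀ j hmin (Finset.mem_powerset.mp hB') (Finset.mem_powerset.mp hD') hcond.1).1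
    · rw [Polynomial.natDegree_zero]; exact Nat.zero_le _
  · rw [genEntry, if_neg hET, map_zero, Polynomial.natDegree_zero]; exact Nat.zero_le _

/-- **Top coefficient of a link-row entry = the PEELED entry.** -/
theorem coeff_linkEntry_top (hs : 1 ≤ s) (hc : Function.Injective c) (haB : ∀ j, a ∉ B j)
    (hcD : ∀ j, c j ∉ D j) (U E T : Finset (Fin h)) (haU : a ∈ U) (j₀ : Fin J)
    (hj₀ : B j₀ ⊆ U.erase a) (hmin : ∀ j', j' < j₀ → ¬ B j' ⊆ U.erase a)
    (hdisj : Disjoint E (insert (c j₀) (D j₀))) :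
    (dtHom a B c D (genEntry s h U E T)).coeff (topW h J j₀) =
      genEntry s h ((U.erase a) \ B j₀) (E ∪ insert (c j₀) (D j₀)) T := by
  classical
  by_cases hET : E ⊆ T
  · rw [dtHom_genEntry_of_mem hs hc haB hcD U E T haU hET, Polynomial.finsetSum_coeff,
      Finset.sum_eq_single_of_mem j₀ (Finset.mem_univ _)]
    · rw [Polynomial.finsetSum_coeff, Finset.sum_eq_single_of_mem (B j₀) (Finset.mem_powerset.mpr subset_rfl)]
      · rw [Polynomial.finsetSum_coeff, Finset.sum_eq_single_of_mem (D j₀) (Finset.mem_powerset.mpr subset_rfl)]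
        · -- the designated term
          rw [genEntry]
          have hw : anchW B D j₀ + ((B j₀).card + (D j₀).card) * tailW J = topW h J j₀ := by
            rw [weight_eq j₀ subset_rfl subset_rfl, topW, tailW, Nat.sub_self, Nat.sub_self, Nat.add_zero, Nat.sub_zero]
          by_cases hcond : insert (c j₀) (D j₀) ⊆ T \ E
          · have hE'T : E ∪ insert (c j₀) (D j₀) ⊆ T :=
              Finset.union_subset hET (hcond.trans Finset.sdiff_subset)
            rw [if_pos ⟨hj₀, hcond⟩, Polynomial.coeff_monomial, if_pos hw, if_pos hE'T, sdiff_sdiff_left,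
              Finset.sup_eq_union]
          · have hE'T : ¬ E ∪ insert (c j₀) (D j₀) ⊆ T := by
              intro hsub
              apply hcond
              intro x hx
              rw [Finset.mem_sdiff]
              exact ⟨hsub (Finset.mem_union_right _ hx), fun hxE => Finset.disjoint_left.mp hdisj hxE hx⟩
            rw [if_neg (fun h' => hcond h'.2), if_neg hE'T, Polynomial.coeff_zero]
        · intro D' hD' hne
          split_ifs with hcond
          · rw [Polynomial.coeff_monomial, if_neg]
            intro heq
            exact hne ((weight_le_topW j₀ j₀ hmin subset_rfl (Finset.mem_powerset.mp hD') hcond.1).2 heq).2.2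
          · exact Polynomial.coeff_zero _
      · intro B' hB' hne
        rw [Polynomial.finsetSum_coeff]
        refine Finset.sum_eq_zero (fun D' hD' => ?_)
        split_ifs with hcond
        · rw [Polynomial.coeff_monomial, if_neg]
          intro heq
          exact hne ((weight_le_topW j₀ j₀ hmin (Finset.mem_powerset.mp hB') (Finset.mem_powerset.mp hD')
            hcond.1).2 heq).2.1
        · exact Polynomial.coeff_zero _
    · intro j _ hne
      rw [Polynomial.finsetSum_coeff]
      refine Finset.sum_eq_zero (fun B' hB' => ?_)
      rw [Polynomial.finsetSum_coeff]
      refine Finset.sum_eq_zero (fun D' hD' => ?_)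
      split_ifs with hcond
      · rw [Polynomial.coeff_monomial, if_neg]
        intro heq
        exact hne ((weight_le_topW j₀ j hmin (Finset.mem_powerset.mp hB') (Finset.mem_powerset.mp hD')
          hcond.1).2 heq).1
      · exact Polynomial.coeff_zero _
  · have hE'T : ¬ E ∪ insert (c j₀) (D j₀) ⊆ T := fun hsub => hET ((Finset.subset_union_left).trans hsub)
    rw [genEntry, if_neg hET, map_zero, Polynomial.coeff_zero, genEntry, if_neg hE'T]

/-- **THE DT-PEEL LEMMA.** Peel the `x`-vertex `a` with the type list `(B_j, c_j, D_j)`: link rows (`a ∈ U i`) of class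
`cls i` (the first type with `B ⊆ U i ∖ a`) become `((U i ∖ a) ∖ B_{cls i} | E i ⊔ c_{cls i} ⊔ D_{cls i})`, the other rows are
kept. If the peeled generalized symbolic minor is nonzero, so is the original one. -/
theorem genDet_ne_zero_of_peel {r : ℕ} (hs : 1 ≤ s) (hc : Function.Injective c) (haB : ∀ j, a ∉ B j)
    (hcD : ∀ j, c j ∉ D j) (U E w : Fin r → Finset (Fin h)) (cls : Fin r → Fin J)
    (hcls : ∀ i, a ∈ U i → B (cls i) ⊆ (U i).erase a)
    (hmin : ∀ i, a ∈ U i → ∀ j, j < cls i → ¬ B j ⊆ (U i).erase a)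
    (hdisj : ∀ i, a ∈ U i → Disjoint (E i) (insert (c (cls i)) (D (cls i))))
    (U' E' : Fin r → Finset (Fin h))
    (hU' : ∀ i, U' i = if a ∈ U i then ((U i).erase a) \ B (cls i) else U i)
    (hE' : ∀ i, E' i = if a ∈ U i then E i ∪ insert (c (cls i)) (D (cls i)) else E i)
    (hne : genDet s h r U' E' w ≠ 0) : genDet s h r U E w ≠ 0 := by
  classical
  intro h0
  apply hne
  let P : Matrix (Fin r) (Fin r) (Polynomial (MvPolynomial (Param h) ℂ)) :=
    Matrix.of fun i j => dtHom a B c D (genEntry s h (U i) (E i) (w j))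
  let d : Fin r → ℕ := fun i => if a ∈ U i then topW h J (cls i) else 0
  have hP : P.det = dtHom a B c D (genDet s h r U E w) := by
    rw [genDet, RingHom.map_det]
    rfl
  have hdeg : ∀ i j, (P i j).natDegree ≤ d i := by
    intro i j
    simp only [P, d, Matrix.of_apply]
    by_cases hi : a ∈ U i
    · rw [if_pos hi]; exact natDegree_linkEntry_le hs hc haB hcD _ _ _ hi (cls i) (hmin i hi)
    · rw [if_neg hi, dtHom_genEntry_of_not_mem hc haB hcD _ _ _ hi, Polynomial.natDegree_C]
  have htop : ∀ i j, (P i j).coeff (d i) = genEntry s h (U' i) (E' i) (w j) := by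
    intro i j
    simp only [P, d, Matrix.of_apply]
    by_cases hi : a ∈ U i
    · rw [if_pos hi, hU' i, hE' i, if_pos hi, if_pos hi]
      exact coeff_linkEntry_top hs hc haB hcD _ _ _ hi (cls i) (hcls i hi) (hmin i hi) (hdisj i hi)
    · rw [if_neg hi, hU' i, hE' i, if_neg hi, if_neg hi, dtHom_genEntry_of_not_mem hc haB hcD _ _ _ hi,
        Polynomial.coeff_C_zero]
  have key := coeff_det_of_natDegree_le_row P d hdeg
  rw [hP, h0, map_zero, Polynomial.coeff_zero] at key
  rw [genDet, genMatrix, key]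
  congr 1
  ext i j
  rw [Matrix.of_apply, Matrix.of_apply, htop]

end Peel

end DTPeel

end

end Summit.ValiantsHypothesis.ValiantsHypothesis.Theorems.BarrierLever.AnchoredPeeling
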